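import Summits.QuantumFields.YangMills.Theorems.BalabanUVNodesK0Stub3CubeLetterBlind
import Summits.QuantumFields.YangMills.Theorems.BalabanUVNodesK0PrintCubeOfStepTokensRFloor
import Literature.MathematicalPhysics.QuantumFieldTheory.Balaban1983to89.Node00.TorusCoverGaugeTokensGuarded

/-!
# K0⁷ — STUB 3ᴬ′ UNDER THE V20 TEXTS (plan g86 WORD V20 = G, 2026-08-28 11:44Z; R = the floor-carrying interim): both SOCKETS ⟸ the token-free ∕ uniform cores of
# `…K0Stub3CubeLetterBlind` (hence ⟸ every landed currency of the stub-3 lane, BY NAME), the strength chain G ⟹ G♭ ⟹ R ⟹ V19, the exact price of the re-text on the stub-3 side,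
# a window-witness ROAD SCHEMA paying every text at once, and K0⁷ BY NAME under the V20-R texts (k0-s1-w3 g7's composition p630277 + stub 2′ p595104)

Cell `pub-ymgap`, width seat `pub-ymgap-k0-s3-w2` (g3; director-ym R399 (3a) ∕ №207 «(j,c)-generic sub-faces of `stub_absBetaBoxAtThm1WitnessCCMGen13` by CLAIM»; bus STARTED +
TRIGGER-AUDIT + CLAIM-1 I.37129).  `--kind proof --supports stmt-QuantumFields-20541 --as helper` (count-neutral).  NEW leaf; theorems only; 0 `def`; nothing modified; no registry write.  [15] = [Balaban1985Variational];
[6] = [Balaban1985RegularSpaces]; [I] = [Balaban1987RG1]; [II] = [Balaban1989LargeFieldII]; [III] = [Balaban1988Convergent].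

WHY.  The N07 lane owner's «V20 STUB-1 TEXT PROPOSAL» (dag-n07-e g20, HOME `pub-ymgap-dag-n07-e/V20-STUB1-TEXT-PROPOSAL.md` 63817cea342ff894) re-letters stub 1 of K0⁷'s skeleton V19
(87879403b3a26109) with a separation FLOOR `c ≤ ν.M₁` (option R, module 46) or a floor-and-level GUARD (option G, module 47; guard `fun ν _M _g K k _s => c ≤ ν.M₁ ∧ k + c₀ ≤ F.m + K`),
and plan g86's WORD (bus I.37134) is **V20 = G**: stub 3ᴬ′ becomes `stub_absBetaBoxAtThm1WitnessCCMGenG13` = V19's text with binders `(j c c₀ : ℕ)` and BOTH antecedents G-lettered with the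
SAME guard (`VariationalThm1RegSepCoP7MG F 2 ⟨guard⟩ B₃ a₀ a₁ →` · `Gauge9RegSepTopStepG F 2 suppDom (F.L ^ j) ⟨guard⟩ B₃ B₃' a₀ a₁ →`), conclusion unchanged; V19 STANDS until the G
composition lands; the interim R composition is in the tree (k0-s1-w3 g7, p630016 ∕ p630277).  THIS FILE is the stub-3 LANE's share of the re-text, typed against the plan's G letters
VERBATIM (§2's text) and k0-s1-w3 g7's displayed variant G♭ with the extra binder `c₀ ≤ j + 1` (one line weaker, §3): by `…K0Stub3CubeLetterBlind` §1 (the β of record at A1's witness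
reads only `(a₀, ε₂₉)`, `rfl`) the antecedent tokens of ANY text only RESTRICT the thresholds `a₀` at which a box is owed — so (§2) each V20 socket is equivalent to its UNIFORM core,
(§3) the TOKEN-FREE core pays G, G♭ and R (hence every landed currency file of the lane — kernel letters p610322, W1 letters p611287, window-uniform (5.10) p608074, fundamental-domain face
p613354, activity slots p616231, window edition p618788, C¹-witness boxes — feeds V20 UNCHANGED), (§4) the sockets are ordered G ⟹ G♭ ⟹ R ⟹ V19 (weaker tokens = stronger socket; R ⟹ V19
is k0-s1-w3's `absBetaBoxAtGen_of_absBetaBoxAtGenR`, BY NAME), and V19 ⟹ R holds EXACTLY under a token lift «R-tokens inhabited at `a₀` ⟹ V19-tokens inhabited at `a₀`» — the located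
price of the re-text on the stub-3 side (NONE for an `a₀`-uniform NODE O bound); (§5) ONE schema: any θ-generic
own-window box road inhabited at ONE small-window witness `θ₁₅ᶜᶜᴹᵂ(j; γ₀)` per threshold pays the token-free core (A2ʷ transfer + letter-blindness), hence every text at once (the
twin schema at A1's witnesses `θ₁₅ᶜᶜᴹ(j)` and the run-wise (3ᴿ) twins are the companion file `…K0Stub3V20RunSockets`); (§6) K0⁷ BY
NAME under the V20-R stub-1 TEXT from: 3ᴬ′-R ∕ 3ᴬ′-G♭ ∕ 3ᴬ′-G ∕ the token-free core ∕ a §5 road (k0-s1-w3 g7's `record13SepCoPHBody_of_stubs1R_2P_3A'R` with stub 2′ discharged BY NAME,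
`K0V19Stub2Prime.stub_prop6MemberB8AtP13` p595104), and from V19's stub-1 text + 3ᴬ′-G.  The G-side hub (K0⁷ from the V20-G stub-1 text) keys on the G composition when it lands
(n07-e g21 INTENT-53∕54 + k0-s1-w3's G twins) — not here.

HONEST FRAMING.  By-name plumbing between typed socket SHAPES over landed letters; NO β estimate; nothing of Bałaban asserted; every [15] ∕ [6] ∕ [I] sentence is a HYPOTHESIS inhabited
nowhere; 3ᴬ′ (any text) remains NODE O's wall ([I] §1 p.264 «uniformly bounded» STATED, proof unpublished [II] p.355); no stub proved; K0⁷ stmt-QuantumFields-20541 OPEN (V19 STANDS — the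
V20-G registration is the plan's act; this file registers nothing; no `sorry`∕`def`∕`instance`∕`notation`∕`axiom`); counts unmoved (typed 28∕28 · discharged 5∕27, A 5∕28).  One finite 𝕋⁴ programme at fixed
`ε = L^{−K}`, Bałaban AS PRINTED — NOT continuum ∕ ℝ⁴ ∕ OS ∕ mass gap ∕ Clay (the Yang–Mills mass gap is NOT proved by any of this; route R4 closes the CONDITIONAL finite-𝕋⁴ rung `BalabanLadder.UV` only).
-/

noncomputable section
open scoped Matrix.Norms.L2Operator
namespace Summit.QuantumFields.YangMills.Theorems.K0Stub3V20Sockets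

open Literature.MathematicalPhysics.QuantumFieldTheory.Balaban1983to89
open Literature.MathematicalPhysics.QuantumFieldTheory.Balaban1983to89.Node00
open Literature.MathematicalPhysics.QuantumFieldTheory.Balaban1983to89.T4Continuum
open Literature.MathematicalPhysics.QuantumFieldTheory.Balaban1983to89.FlowStep
open Summit.QuantumFields.YangMills.Theorems.K0V19Defs (Prop8StepCoPAt AbsBetaBoxAtThm1WitnessCCMGenAt)
open Summit.QuantumFields.YangMills.Theorems.K0V19Stub2Prime (stub_prop6MemberB8AtP13 record13SepCoPHInhabited_of_stub1_stub3A'_byName)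
open Summit.QuantumFields.YangMills.Theorems.K0Stub3CubeLetterBlind (betaOfRecord₁₃_theta13OfThm1CCM_letterBlind absBetaBoxGenAt_iff_uniform)
open Summit.QuantumFields.YangMills.Theorems.K0AllTorusOfStepTokensRFloor (absBetaBoxAtGen_of_absBetaBoxAtGenR)
open Summit.QuantumFields.YangMills.Theorems.K0PrintCubeOfStepTokensRFloor (record13SepCoPHBody_of_stubs1R_2P_3A'R)

variable (F : T4Family)

/-! ## §1  The tokens: V19's ⟹ R's ⟹ G's (module 49 ∕ module 47 ∕ p627663 adapters, read at the socket's prefix) -/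

section Tokens

/-- **V19's ANTECEDENT TOKENS GIVE R's AT EVERY FLOOR `c`**: [15] Thm 1 (8) floor-free ⟹ floor-carrying (`VariationalThm1RegSepCoP7M.toR`); the (9)-token is already floor-carrying
in V19.  Bookkeeping. [cite: Balaban1985Variational, Thm 1 (8)–(9) p.279, p.304 lines 1–2 (bookkeeping); Balaban1985RegularSpaces, (1.3)–(1.6) p.77] -/
theorem tokensR_of_tokensV19 {j c : ℕ} {B₃ B₃' a₀ a₁ : ℝ} (h15 : VariationalThm1RegSepCoP7M F 2 B₃ a₀ a₁)
    (h9 : Gauge9RegSepTopStepR F 2 (fun ν K Ω => suppDomOfRecord F ν K Ω) (F.L ^ j) c B₃ B₃' a₀ a₁) :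
    VariationalThm1RegSepCoP7MR F 2 c B₃ a₀ a₁ ∧ Gauge9RegSepTopStepR F 2 (fun ν K Ω => suppDomOfRecord F ν K Ω) (F.L ^ j) c B₃ B₃' a₀ a₁ :=
  ⟨h15.toR c, h9⟩

/-- **R's ANTECEDENT TOKENS AT FLOOR `c` GIVE G's AT THE PLAN's GUARD `c ≤ ν.M₁ ∧ k + c₀ ≤ F.m + K`, EVERY `c₀`** (the guard implies its floor: `.toG_of_imp_floor`, module 49 ∕
p627663).  Bookkeeping. [cite: Balaban1985Variational, Thm 1 (8)–(9) p.279, p.304 lines 1–2 (bookkeeping); Balaban1985RegularSpaces, (1.3)–(1.6) p.77; Balaban1987RG1, (0.1) p.251] -/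
theorem tokensG_of_tokensR {j c : ℕ} (c₀ : ℕ) {B₃ B₃' a₀ a₁ : ℝ} (h15 : VariationalThm1RegSepCoP7MR F 2 c B₃ a₀ a₁)
    (h9 : Gauge9RegSepTopStepR F 2 (fun ν K Ω => suppDomOfRecord F ν K Ω) (F.L ^ j) c B₃ B₃' a₀ a₁) :
    VariationalThm1RegSepCoP7MG F 2 (fun ν _M _g K k _s => c ≤ ν.M₁ ∧ k + c₀ ≤ F.m + K) B₃ a₀ a₁ ∧
      Gauge9RegSepTopStepG F 2 (fun ν K Ω => suppDomOfRecord F ν K Ω) (F.L ^ j) (fun ν _M _g K k _s => c ≤ ν.M₁ ∧ k + c₀ ≤ F.m + K) B₃ B₃' a₀ a₁ :=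
  ⟨h15.toG_of_imp_floor fun _ _ _ _ _ _ h => h.1, h9.toG_of_imp_floor fun _ _ _ _ _ _ h => h.1⟩

end Tokens

/-! ## §2  ★ The two V20 sockets ⟺ their UNIFORM cores ((j, c[, c₀])-genericity is free — `…CubeLetterBlind` §1) -/

section Uniform

/-- **★ 3ᴬ′-R ⟺ ITS UNIFORM CORE.**  The option-R stub-3 text (k0-s1-w3 g7's `h3A'R` ∕ p630277 at one family: V19's VERBATIM with the FIRST antecedent floor-carrying at the SAME `c` as
the (9)-antecedent) holds iff for every threshold `a₀ > 0` AT WHICH the floor-carrying (8)-sentence and (9)-token are inhabited (any cube letter `c ≤ L^j` and constants), SOME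
`γ₀, ε₂₉ > 0`, `β′` box `β₁₃(θ₁₅ᶜᶜᴹ(j; ε₀, ε₂₉; B₃, B₃′, a₀, a₁))` on `]0, γ₀]` SIMULTANEOUSLY for all `j, ε₀, B₃, B₃′, a₁` (one function by `…_letterBlind`).  A repackaging; nothing asserted.
[cite: Balaban1987RG1, Thm 1 p.259, §1 (1.20)–(1.22) p.264, (2.9) p.266; Balaban1985Variational, Thm 1 (8)–(9) p.279, p.304 lines 1–2; Balaban1989LargeFieldII, p.355] -/
theorem abs3A'R_iff_uniformR :
    (∀ (j c : ℕ) (B₃ B₃' a₀ a₁ : ℝ), c ≤ F.L ^ j → 2 * (F.L : ℝ) ^ 2 ≤ B₃ → 0 < B₃' → 0 < a₀ → 0 < a₁ →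
      VariationalThm1RegSepCoP7MR F 2 c B₃ a₀ a₁ →
      Gauge9RegSepTopStepR F 2 (fun ν K Ω => suppDomOfRecord F ν K Ω) (F.L ^ j) c B₃ B₃' a₀ a₁ →
      ∃ γ₀ ε₀ ε₂₉ β' : ℝ, 0 < γ₀ ∧ 0 < ε₀ ∧ 0 < ε₂₉ ∧
        BetaLowerH (-β') γ₀ (betaOfRecord₁₃ F 2 (theta13OfThm1CCM F 2 j ε₀ ε₂₉ B₃ B₃' a₀ a₁)) ∧
        BetaUpperH β' γ₀ (betaOfRecord₁₃ F 2 (theta13OfThm1CCM F 2 j ε₀ ε₂₉ B₃ B₃' a₀ a₁))) ↔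
      ∀ a₀ : ℝ, 0 < a₀ →
        (∃ (j c : ℕ) (B₃ B₃' a₁ : ℝ), c ≤ F.L ^ j ∧ 2 * (F.L : ℝ) ^ 2 ≤ B₃ ∧ 0 < B₃' ∧ 0 < a₁ ∧
          VariationalThm1RegSepCoP7MR F 2 c B₃ a₀ a₁ ∧
          Gauge9RegSepTopStepR F 2 (fun ν K Ω => suppDomOfRecord F ν K Ω) (F.L ^ j) c B₃ B₃' a₀ a₁) →
        ∃ γ₀ ε₂₉ β' : ℝ, 0 < γ₀ ∧ 0 < ε₂₉ ∧ ∀ (j : ℕ) (ε₀ B₃ B₃' a₁ : ℝ),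
          BetaLowerH (-β') γ₀ (betaOfRecord₁₃ F 2 (theta13OfThm1CCM F 2 j ε₀ ε₂₉ B₃ B₃' a₀ a₁)) ∧
          BetaUpperH β' γ₀ (betaOfRecord₁₃ F 2 (theta13OfThm1CCM F 2 j ε₀ ε₂₉ B₃ B₃' a₀ a₁)) := by
  constructor
  · rintro h a₀ ha₀ ⟨j, c, B₃, B₃', a₁, hc, hB₃, hB₃', ha₁, h15, h9⟩
    obtain ⟨γ₀, ε₀, ε₂₉, β', hγ₀, -, hε', hlow, hup⟩ := h j c B₃ B₃' a₀ a₁ hc hB₃ hB₃' ha₀ ha₁ h15 h9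
    refine ⟨γ₀, ε₂₉, β', hγ₀, hε', fun j' ε₀' C₃ C₃' c₁ => ?_⟩
    rw [betaOfRecord₁₃_theta13OfThm1CCM_letterBlind F 2 j' j ε₀' ε₀ ε₂₉ C₃ B₃ C₃' B₃' a₀ c₁ a₁]
    exact ⟨hlow, hup⟩
  · intro h j c B₃ B₃' a₀ a₁ hc hB₃ hB₃' ha₀ ha₁ h15 h9
    obtain ⟨γ₀, ε₂₉, β', hγ₀, hε', hall⟩ := h a₀ ha₀ ⟨j, c, B₃, B₃', a₁, hc, hB₃, hB₃', ha₁, h15, h9⟩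
    exact ⟨γ₀, 1, ε₂₉, β', hγ₀, one_pos, hε', (hall j 1 B₃ B₃' a₁).1, (hall j 1 B₃ B₃' a₁).2⟩

/-- **★ 3ᴬ′-G ⟺ ITS UNIFORM CORE.**  The plan's V20-G stub-3 text `stub_absBetaBoxAtThm1WitnessCCMGenG13` (WORD V20 = G: V19's text with binders `(j c c₀ : ℕ)` and BOTH antecedents
G-lettered at the guard `fun ν _M _g K k _s => c ≤ ν.M₁ ∧ k + c₀ ≤ F.m + K`, conclusion unchanged) holds iff for every threshold `a₀ > 0` at which the guarded (8)-sentence and (9)-token are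
inhabited (any `j, c, c₀` and constants), SOME `γ₀, ε₂₉ > 0`, `β′` box the ONE family `β₁₃(F; a₀, ε₂₉)` on `]0, γ₀]` for all `j, ε₀, B₃, B₃′, a₁`.  A repackaging; nothing asserted.
[cite: Balaban1987RG1, Thm 1 p.259, §1 (1.20)–(1.22) p.264, (2.9) p.266, (0.1) p.251; Balaban1985Variational, Thm 1 (8)–(9) p.279, p.304 lines 1–2; Balaban1989LargeFieldII, p.355] -/
theorem abs3A'G_iff_uniformG :
    (∀ (j c c₀ : ℕ) (B₃ B₃' a₀ a₁ : ℝ), c ≤ F.L ^ j → 2 * (F.L : ℝ) ^ 2 ≤ B₃ → 0 < B₃' → 0 < a₀ → 0 < a₁ →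
      VariationalThm1RegSepCoP7MG F 2 (fun ν _M _g K k _s => c ≤ ν.M₁ ∧ k + c₀ ≤ F.m + K) B₃ a₀ a₁ →
      Gauge9RegSepTopStepG F 2 (fun ν K Ω => suppDomOfRecord F ν K Ω) (F.L ^ j) (fun ν _M _g K k _s => c ≤ ν.M₁ ∧ k + c₀ ≤ F.m + K) B₃ B₃' a₀ a₁ →
      ∃ γ₀ ε₀ ε₂₉ β' : ℝ, 0 < γ₀ ∧ 0 < ε₀ ∧ 0 < ε₂₉ ∧
        BetaLowerH (-β') γ₀ (betaOfRecord₁₃ F 2 (theta13OfThm1CCM F 2 j ε₀ ε₂₉ B₃ B₃' a₀ a₁)) ∧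
        BetaUpperH β' γ₀ (betaOfRecord₁₃ F 2 (theta13OfThm1CCM F 2 j ε₀ ε₂₉ B₃ B₃' a₀ a₁))) ↔
      ∀ a₀ : ℝ, 0 < a₀ →
        (∃ (j c c₀ : ℕ) (B₃ B₃' a₁ : ℝ), c ≤ F.L ^ j ∧ 2 * (F.L : ℝ) ^ 2 ≤ B₃ ∧ 0 < B₃' ∧ 0 < a₁ ∧
          VariationalThm1RegSepCoP7MG F 2 (fun ν _M _g K k _s => c ≤ ν.M₁ ∧ k + c₀ ≤ F.m + K) B₃ a₀ a₁ ∧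
          Gauge9RegSepTopStepG F 2 (fun ν K Ω => suppDomOfRecord F ν K Ω) (F.L ^ j) (fun ν _M _g K k _s => c ≤ ν.M₁ ∧ k + c₀ ≤ F.m + K) B₃ B₃' a₀ a₁) →
        ∃ γ₀ ε₂₉ β' : ℝ, 0 < γ₀ ∧ 0 < ε₂₉ ∧ ∀ (j : ℕ) (ε₀ B₃ B₃' a₁ : ℝ),
          BetaLowerH (-β') γ₀ (betaOfRecord₁₃ F 2 (theta13OfThm1CCM F 2 j ε₀ ε₂₉ B₃ B₃' a₀ a₁)) ∧
          BetaUpperH β' γ₀ (betaOfRecord₁₃ F 2 (theta13OfThm1CCM F 2 j ε₀ ε₂₉ B₃ B₃' a₀ a₁)) := by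
  constructor
  · rintro h a₀ ha₀ ⟨j, c, c₀, B₃, B₃', a₁, hc, hB₃, hB₃', ha₁, h15, h9⟩
    obtain ⟨γ₀, ε₀, ε₂₉, β', hγ₀, -, hε', hlow, hup⟩ := h j c c₀ B₃ B₃' a₀ a₁ hc hB₃ hB₃' ha₀ ha₁ h15 h9
    refine ⟨γ₀, ε₂₉, β', hγ₀, hε', fun j' ε₀' C₃ C₃' c₁ => ?_⟩
    rw [betaOfRecord₁₃_theta13OfThm1CCM_letterBlind F 2 j' j ε₀' ε₀ ε₂₉ C₃ B₃ C₃' B₃' a₀ c₁ a₁]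
    exact ⟨hlow, hup⟩
  · intro h j c c₀ B₃ B₃' a₀ a₁ hc hB₃ hB₃' ha₀ ha₁ h15 h9
    obtain ⟨γ₀, ε₂₉, β', hγ₀, hε', hall⟩ := h a₀ ha₀ ⟨j, c, c₀, B₃, B₃', a₁, hc, hB₃, hB₃', ha₁, h15, h9⟩
    exact ⟨γ₀, 1, ε₂₉, β', hγ₀, one_pos, hε', (hall j 1 B₃ B₃' a₁).1, (hall j 1 B₃ B₃' a₁).2⟩

end Uniform

/-! ## §3  ★ The TOKEN-FREE core pays every V20 text (so every landed currency of the lane feeds V20 unchanged); G ⟹ G♭ -/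

section TokenFree

/-- **★ THE TOKEN-FREE CORE PAYS 3ᴬ′-R**: a sign-free box of the family `β₁₃(F; a₀, ε₂₉)` for EVERY `a₀ > 0` at SOME `ε₂₉ > 0` (`…CubeLetterBlind.absBetaBoxGenAt_of_tokenFree`'s
hypothesis VERBATIM) gives the option-R stub-3 text at `F` — the R-tokens only RESTRICT the thresholds at which the box is owed.  CONDITIONAL; nothing asserted.
[cite: Balaban1987RG1, Thm 1 p.259, §1 (1.20)–(1.22) p.264; Balaban1985Variational, Thm 1 (8)–(9) p.279, p.304 lines 1–2; Balaban1989LargeFieldII, p.355] -/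
theorem abs3A'R_of_tokenFree
    (h : ∀ a₀ : ℝ, 0 < a₀ → ∃ γ₀ ε₂₉ β' : ℝ, 0 < γ₀ ∧ 0 < ε₂₉ ∧ ∀ (j : ℕ) (ε₀ B₃ B₃' a₁ : ℝ),
      BetaLowerH (-β') γ₀ (betaOfRecord₁₃ F 2 (theta13OfThm1CCM F 2 j ε₀ ε₂₉ B₃ B₃' a₀ a₁)) ∧
      BetaUpperH β' γ₀ (betaOfRecord₁₃ F 2 (theta13OfThm1CCM F 2 j ε₀ ε₂₉ B₃ B₃' a₀ a₁))) :
    ∀ (j c : ℕ) (B₃ B₃' a₀ a₁ : ℝ), c ≤ F.L ^ j → 2 * (F.L : ℝ) ^ 2 ≤ B₃ → 0 < B₃' → 0 < a₀ → 0 < a₁ →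
      VariationalThm1RegSepCoP7MR F 2 c B₃ a₀ a₁ →
      Gauge9RegSepTopStepR F 2 (fun ν K Ω => suppDomOfRecord F ν K Ω) (F.L ^ j) c B₃ B₃' a₀ a₁ →
      ∃ γ₀ ε₀ ε₂₉ β' : ℝ, 0 < γ₀ ∧ 0 < ε₀ ∧ 0 < ε₂₉ ∧
        BetaLowerH (-β') γ₀ (betaOfRecord₁₃ F 2 (theta13OfThm1CCM F 2 j ε₀ ε₂₉ B₃ B₃' a₀ a₁)) ∧
        BetaUpperH β' γ₀ (betaOfRecord₁₃ F 2 (theta13OfThm1CCM F 2 j ε₀ ε₂₉ B₃ B₃' a₀ a₁)) :=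
  (abs3A'R_iff_uniformR F).mpr fun a₀ ha₀ _ => h a₀ ha₀

/-- **★ THE TOKEN-FREE CORE PAYS THE PLAN's 3ᴬ′-G** (same hypothesis; the G-tokens only restrict the thresholds).  CONDITIONAL; nothing asserted.
[cite: Balaban1987RG1, Thm 1 p.259, §1 (1.20)–(1.22) p.264, (0.1) p.251; Balaban1985Variational, Thm 1 (8)–(9) p.279, p.304 lines 1–2; Balaban1989LargeFieldII, p.355] -/
theorem abs3A'G_of_tokenFree
    (h : ∀ a₀ : ℝ, 0 < a₀ → ∃ γ₀ ε₂₉ β' : ℝ, 0 < γ₀ ∧ 0 < ε₂₉ ∧ ∀ (j : ℕ) (ε₀ B₃ B₃' a₁ : ℝ),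
      BetaLowerH (-β') γ₀ (betaOfRecord₁₃ F 2 (theta13OfThm1CCM F 2 j ε₀ ε₂₉ B₃ B₃' a₀ a₁)) ∧
      BetaUpperH β' γ₀ (betaOfRecord₁₃ F 2 (theta13OfThm1CCM F 2 j ε₀ ε₂₉ B₃ B₃' a₀ a₁))) :
    ∀ (j c c₀ : ℕ) (B₃ B₃' a₀ a₁ : ℝ), c ≤ F.L ^ j → 2 * (F.L : ℝ) ^ 2 ≤ B₃ → 0 < B₃' → 0 < a₀ → 0 < a₁ →
      VariationalThm1RegSepCoP7MG F 2 (fun ν _M _g K k _s => c ≤ ν.M₁ ∧ k + c₀ ≤ F.m + K) B₃ a₀ a₁ →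
      Gauge9RegSepTopStepG F 2 (fun ν K Ω => suppDomOfRecord F ν K Ω) (F.L ^ j) (fun ν _M _g K k _s => c ≤ ν.M₁ ∧ k + c₀ ≤ F.m + K) B₃ B₃' a₀ a₁ →
      ∃ γ₀ ε₀ ε₂₉ β' : ℝ, 0 < γ₀ ∧ 0 < ε₀ ∧ 0 < ε₂₉ ∧
        BetaLowerH (-β') γ₀ (betaOfRecord₁₃ F 2 (theta13OfThm1CCM F 2 j ε₀ ε₂₉ B₃ B₃' a₀ a₁)) ∧
        BetaUpperH β' γ₀ (betaOfRecord₁₃ F 2 (theta13OfThm1CCM F 2 j ε₀ ε₂₉ B₃ B₃' a₀ a₁)) :=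
  (abs3A'G_iff_uniformG F).mpr fun a₀ ha₀ _ => h a₀ ha₀

/-- **G ⟹ G♭**: the plan's text gives k0-s1-w3 g7's displayed variant with the extra level-guard binder `c₀ ≤ j + 1` (bus S.22687: «drop it and the stub only gets stronger») by ignoring
the binder.  Bookkeeping. [cite: Balaban1985Variational, Thm 1 (8)–(9) p.279 (bookkeeping); Balaban1987RG1, §1 p.264, (0.1) p.251] -/
theorem abs3A'Gb_of_abs3A'G
    (h : ∀ (j c c₀ : ℕ) (B₃ B₃' a₀ a₁ : ℝ), c ≤ F.L ^ j → 2 * (F.L : ℝ) ^ 2 ≤ B₃ → 0 < B₃' → 0 < a₀ → 0 < a₁ →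
      VariationalThm1RegSepCoP7MG F 2 (fun ν _M _g K k _s => c ≤ ν.M₁ ∧ k + c₀ ≤ F.m + K) B₃ a₀ a₁ →
      Gauge9RegSepTopStepG F 2 (fun ν K Ω => suppDomOfRecord F ν K Ω) (F.L ^ j) (fun ν _M _g K k _s => c ≤ ν.M₁ ∧ k + c₀ ≤ F.m + K) B₃ B₃' a₀ a₁ →
      ∃ γ₀ ε₀ ε₂₉ β' : ℝ, 0 < γ₀ ∧ 0 < ε₀ ∧ 0 < ε₂₉ ∧
        BetaLowerH (-β') γ₀ (betaOfRecord₁₃ F 2 (theta13OfThm1CCM F 2 j ε₀ ε₂₉ B₃ B₃' a₀ a₁)) ∧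
        BetaUpperH β' γ₀ (betaOfRecord₁₃ F 2 (theta13OfThm1CCM F 2 j ε₀ ε₂₉ B₃ B₃' a₀ a₁))) :
    ∀ (j c c₀ : ℕ) (B₃ B₃' a₀ a₁ : ℝ), c ≤ F.L ^ j → c₀ ≤ j + 1 → 2 * (F.L : ℝ) ^ 2 ≤ B₃ → 0 < B₃' → 0 < a₀ → 0 < a₁ →
      VariationalThm1RegSepCoP7MG F 2 (fun ν _M _g K k _s => c ≤ ν.M₁ ∧ k + c₀ ≤ F.m + K) B₃ a₀ a₁ →
      Gauge9RegSepTopStepG F 2 (fun ν K Ω => suppDomOfRecord F ν K Ω) (F.L ^ j) (fun ν _M _g K k _s => c ≤ ν.M₁ ∧ k + c₀ ≤ F.m + K) B₃ B₃' a₀ a₁ →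
      ∃ γ₀ ε₀ ε₂₉ β' : ℝ, 0 < γ₀ ∧ 0 < ε₀ ∧ 0 < ε₂₉ ∧
        BetaLowerH (-β') γ₀ (betaOfRecord₁₃ F 2 (theta13OfThm1CCM F 2 j ε₀ ε₂₉ B₃ B₃' a₀ a₁)) ∧
        BetaUpperH β' γ₀ (betaOfRecord₁₃ F 2 (theta13OfThm1CCM F 2 j ε₀ ε₂₉ B₃ B₃' a₀ a₁)) :=
  fun j c c₀ B₃ B₃' a₀ a₁ hc _ => h j c c₀ B₃ B₃' a₀ a₁ hc

end TokenFree

/-! ## §4  The strength chain G ⟹ G♭ ⟹ R ⟹ V19, and the exact price of the re-text on the stub-3 side -/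

section Chain

/-- **★ 3ᴬ′-G♭ ⟹ 3ᴬ′-R** (hence G ⟹ R): R-tokens at `(j, c)` are G-tokens at `(j, c, c₀ := 0)` (§1), and `0 ≤ j + 1`.  So BOTH guarded texts are STRONGER sockets than R's; displayed
honestly: a by-name proof of the R text does NOT pay the G texts. [cite: Balaban1985Variational, Thm 1 (8)–(9) p.279, p.304 lines 1–2 (bookkeeping); Balaban1987RG1, Thm 1 p.259, §1 p.264, (0.1) p.251] -/
theorem abs3A'R_of_abs3A'Gb
    (h : ∀ (j c c₀ : ℕ) (B₃ B₃' a₀ a₁ : ℝ), c ≤ F.L ^ j → c₀ ≤ j + 1 → 2 * (F.L : ℝ) ^ 2 ≤ B₃ → 0 < B₃' → 0 < a₀ → 0 < a₁ →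
      VariationalThm1RegSepCoP7MG F 2 (fun ν _M _g K k _s => c ≤ ν.M₁ ∧ k + c₀ ≤ F.m + K) B₃ a₀ a₁ →
      Gauge9RegSepTopStepG F 2 (fun ν K Ω => suppDomOfRecord F ν K Ω) (F.L ^ j) (fun ν _M _g K k _s => c ≤ ν.M₁ ∧ k + c₀ ≤ F.m + K) B₃ B₃' a₀ a₁ →
      ∃ γ₀ ε₀ ε₂₉ β' : ℝ, 0 < γ₀ ∧ 0 < ε₀ ∧ 0 < ε₂₉ ∧
        BetaLowerH (-β') γ₀ (betaOfRecord₁₃ F 2 (theta13OfThm1CCM F 2 j ε₀ ε₂₉ B₃ B₃' a₀ a₁)) ∧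
        BetaUpperH β' γ₀ (betaOfRecord₁₃ F 2 (theta13OfThm1CCM F 2 j ε₀ ε₂₉ B₃ B₃' a₀ a₁))) :
    ∀ (j c : ℕ) (B₃ B₃' a₀ a₁ : ℝ), c ≤ F.L ^ j → 2 * (F.L : ℝ) ^ 2 ≤ B₃ → 0 < B₃' → 0 < a₀ → 0 < a₁ →
      VariationalThm1RegSepCoP7MR F 2 c B₃ a₀ a₁ →
      Gauge9RegSepTopStepR F 2 (fun ν K Ω => suppDomOfRecord F ν K Ω) (F.L ^ j) c B₃ B₃' a₀ a₁ →
      ∃ γ₀ ε₀ ε₂₉ β' : ℝ, 0 < γ₀ ∧ 0 < ε₀ ∧ 0 < ε₂₉ ∧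
        BetaLowerH (-β') γ₀ (betaOfRecord₁₃ F 2 (theta13OfThm1CCM F 2 j ε₀ ε₂₉ B₃ B₃' a₀ a₁)) ∧
        BetaUpperH β' γ₀ (betaOfRecord₁₃ F 2 (theta13OfThm1CCM F 2 j ε₀ ε₂₉ B₃ B₃' a₀ a₁)) := by
  intro j c B₃ B₃' a₀ a₁ hc hB hB' ha₀ ha₁ h15 h9
  obtain ⟨h15G, h9G⟩ := tokensG_of_tokensR F 0 h15 h9
  exact h j c 0 B₃ B₃' a₀ a₁ hc (Nat.zero_le _) hB hB' ha₀ ha₁ h15G h9G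

/-- **★ THE PLAN's 3ᴬ′-G ⟹ 3ᴬ′-R** (§3's G ⟹ G♭, then `abs3A'R_of_abs3A'Gb`). [cite: Balaban1985Variational, Thm 1 (8)–(9) p.279 (bookkeeping); Balaban1987RG1, Thm 1 p.259, §1 p.264, (0.1) p.251] -/
theorem abs3A'R_of_abs3A'G
    (h : ∀ (j c c₀ : ℕ) (B₃ B₃' a₀ a₁ : ℝ), c ≤ F.L ^ j → 2 * (F.L : ℝ) ^ 2 ≤ B₃ → 0 < B₃' → 0 < a₀ → 0 < a₁ →
      VariationalThm1RegSepCoP7MG F 2 (fun ν _M _g K k _s => c ≤ ν.M₁ ∧ k + c₀ ≤ F.m + K) B₃ a₀ a₁ →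
      Gauge9RegSepTopStepG F 2 (fun ν K Ω => suppDomOfRecord F ν K Ω) (F.L ^ j) (fun ν _M _g K k _s => c ≤ ν.M₁ ∧ k + c₀ ≤ F.m + K) B₃ B₃' a₀ a₁ →
      ∃ γ₀ ε₀ ε₂₉ β' : ℝ, 0 < γ₀ ∧ 0 < ε₀ ∧ 0 < ε₂₉ ∧
        BetaLowerH (-β') γ₀ (betaOfRecord₁₃ F 2 (theta13OfThm1CCM F 2 j ε₀ ε₂₉ B₃ B₃' a₀ a₁)) ∧
        BetaUpperH β' γ₀ (betaOfRecord₁₃ F 2 (theta13OfThm1CCM F 2 j ε₀ ε₂₉ B₃ B₃' a₀ a₁))) :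
    ∀ (j c : ℕ) (B₃ B₃' a₀ a₁ : ℝ), c ≤ F.L ^ j → 2 * (F.L : ℝ) ^ 2 ≤ B₃ → 0 < B₃' → 0 < a₀ → 0 < a₁ →
      VariationalThm1RegSepCoP7MR F 2 c B₃ a₀ a₁ →
      Gauge9RegSepTopStepR F 2 (fun ν K Ω => suppDomOfRecord F ν K Ω) (F.L ^ j) c B₃ B₃' a₀ a₁ →
      ∃ γ₀ ε₀ ε₂₉ β' : ℝ, 0 < γ₀ ∧ 0 < ε₀ ∧ 0 < ε₂₉ ∧
        BetaLowerH (-β') γ₀ (betaOfRecord₁₃ F 2 (theta13OfThm1CCM F 2 j ε₀ ε₂₉ B₃ B₃' a₀ a₁)) ∧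
        BetaUpperH β' γ₀ (betaOfRecord₁₃ F 2 (theta13OfThm1CCM F 2 j ε₀ ε₂₉ B₃ B₃' a₀ a₁)) :=
  abs3A'R_of_abs3A'Gb F (abs3A'Gb_of_abs3A'G F h)

/-- **THE PLAN's 3ᴬ′-G ⟹ V19's REGISTERED 3ᴬ′** `K0V19Defs.AbsBetaBoxAtThm1WitnessCCMGenAt F` (G ⟹ R here, R ⟹ V19 = k0-s1-w3 g7's `absBetaBoxAtGen_of_absBetaBoxAtGenR` p630016, BY
NAME).  So a by-name proof of the G text lands V19's stub by one line today, and V20-G's by name once registered. [cite: Balaban1985Variational, Thm 1 (8)–(9) p.279 (bookkeeping); Balaban1987RG1, Thm 1 p.259, §1 p.264; Balaban1989LargeFieldII, p.355] -/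
theorem abs3A'V19_of_abs3A'G
    (h : ∀ (j c c₀ : ℕ) (B₃ B₃' a₀ a₁ : ℝ), c ≤ F.L ^ j → 2 * (F.L : ℝ) ^ 2 ≤ B₃ → 0 < B₃' → 0 < a₀ → 0 < a₁ →
      VariationalThm1RegSepCoP7MG F 2 (fun ν _M _g K k _s => c ≤ ν.M₁ ∧ k + c₀ ≤ F.m + K) B₃ a₀ a₁ →
      Gauge9RegSepTopStepG F 2 (fun ν K Ω => suppDomOfRecord F ν K Ω) (F.L ^ j) (fun ν _M _g K k _s => c ≤ ν.M₁ ∧ k + c₀ ≤ F.m + K) B₃ B₃' a₀ a₁ →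
      ∃ γ₀ ε₀ ε₂₉ β' : ℝ, 0 < γ₀ ∧ 0 < ε₀ ∧ 0 < ε₂₉ ∧
        BetaLowerH (-β') γ₀ (betaOfRecord₁₃ F 2 (theta13OfThm1CCM F 2 j ε₀ ε₂₉ B₃ B₃' a₀ a₁)) ∧
        BetaUpperH β' γ₀ (betaOfRecord₁₃ F 2 (theta13OfThm1CCM F 2 j ε₀ ε₂₉ B₃ B₃' a₀ a₁))) :
    AbsBetaBoxAtThm1WitnessCCMGenAt F :=
  absBetaBoxAtGen_of_absBetaBoxAtGenR F (abs3A'R_of_abs3A'G F h)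

/-- **★ THE EXACT PRICE OF THE RE-TEXT ON THE STUB-3 SIDE (LOCATED)**: V19's registered 3ᴬ′ pays the R text IFF (given it) a TOKEN LIFT holds — at every threshold `a₀` at which the
floor-carrying tokens are inhabited (some cube letter and constants), V19's floor-free tokens are inhabited too (possibly at another letter and constants).  So: with an `a₀`-UNIFORM
NODE O bound (the token-free core) the re-text costs NOTHING on this side (§3); with a bound tied to V19's token set it costs exactly this lift — a stub-1-side fact ([15] Prop. 8's top
step floor-free at that `a₀`), displayed, NOT claimed.  The G texts cost the analogous lift to R-tokens (c₀ := 0, §4) — nothing more. [cite: Balaban1985Variational, Thm 1 (8)–(9) p.279, Prop. 8 p.304, p.304 lines 1–2; Balaban1987RG1, Thm 1 p.259, §1 p.264; Balaban1989LargeFieldII, p.355] -/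
theorem abs3A'R_of_abs3A'V19_of_tokenLift (h : AbsBetaBoxAtThm1WitnessCCMGenAt F)
    (hlift : ∀ a₀ : ℝ, 0 < a₀ →
      (∃ (j c : ℕ) (B₃ B₃' a₁ : ℝ), c ≤ F.L ^ j ∧ 2 * (F.L : ℝ) ^ 2 ≤ B₃ ∧ 0 < B₃' ∧ 0 < a₁ ∧
        VariationalThm1RegSepCoP7MR F 2 c B₃ a₀ a₁ ∧
        Gauge9RegSepTopStepR F 2 (fun ν K Ω => suppDomOfRecord F ν K Ω) (F.L ^ j) c B₃ B₃' a₀ a₁) →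
      ∃ (j c : ℕ) (B₃ B₃' a₁ : ℝ), c ≤ F.L ^ j ∧ 2 * (F.L : ℝ) ^ 2 ≤ B₃ ∧ 0 < B₃' ∧ 0 < a₁ ∧
        VariationalThm1RegSepCoP7M F 2 B₃ a₀ a₁ ∧
        Gauge9RegSepTopStepR F 2 (fun ν K Ω => suppDomOfRecord F ν K Ω) (F.L ^ j) c B₃ B₃' a₀ a₁) :
    ∀ (j c : ℕ) (B₃ B₃' a₀ a₁ : ℝ), c ≤ F.L ^ j → 2 * (F.L : ℝ) ^ 2 ≤ B₃ → 0 < B₃' → 0 < a₀ → 0 < a₁ →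
      VariationalThm1RegSepCoP7MR F 2 c B₃ a₀ a₁ →
      Gauge9RegSepTopStepR F 2 (fun ν K Ω => suppDomOfRecord F ν K Ω) (F.L ^ j) c B₃ B₃' a₀ a₁ →
      ∃ γ₀ ε₀ ε₂₉ β' : ℝ, 0 < γ₀ ∧ 0 < ε₀ ∧ 0 < ε₂₉ ∧
        BetaLowerH (-β') γ₀ (betaOfRecord₁₃ F 2 (theta13OfThm1CCM F 2 j ε₀ ε₂₉ B₃ B₃' a₀ a₁)) ∧
        BetaUpperH β' γ₀ (betaOfRecord₁₃ F 2 (theta13OfThm1CCM F 2 j ε₀ ε₂₉ B₃ B₃' a₀ a₁)) :=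
  (abs3A'R_iff_uniformR F).mpr fun a₀ ha₀ htok => (absBetaBoxGenAt_iff_uniform F).mp h a₀ ha₀ (hlift a₀ ha₀ htok)

end Chain

/-! ## §5  ★★ The ROAD SCHEMA: a θ-generic own-window box road inhabited at ONE small-window witness per threshold pays the token-free core (every text at once) -/

section Schema

/-- **★★ SMALL-WINDOW WITNESSES.**  Let `P θ` be any package of letters on Stage-13 parameters for which the lane holds a θ-generic box road on the parameter's OWN window
(`P θ → 0 < θ.γ → ∃ β′, BetaLowerH (−β′) θ.γ β₁₃(θ) ∧ BetaUpperH β′ θ.γ β₁₃(θ)` — kernel letters p610322, W1's finite-volume letters p611287, the fundamental-domain face p613354, N22's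
activity slots p616231 ∕ p618788 §2, …).  If for every threshold `a₀ > 0` the package is inhabited at ONE window witness `θ₁₅ᶜᶜᴹᵂ(j; γ₀, ε₀, ε₂₉; B₃, B₃′, a₀, a₁)` with `0 < γ₀ ≤ ½`,
`0 < ε₂₉` — ANY one cube letter and constants — then the TOKEN-FREE core holds at `F`: A2ʷ's transfer reads the `γ₀`-box at A1's witness `θ₁₅ᶜᶜᴹ(j; ε₀, ε₂₉; …)`, and letter-blindness
spreads it over all `(j, ε₀, B₃, B₃′, a₁)`.  Feed §3 (R ∕ G) or `…CubeLetterBlind.absBetaBoxGenAt_of_tokenFree` (V19).  CONDITIONAL on the road and on `P` (displayed); nothing asserted.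
[cite: Balaban1987RG1, Thm 1 p.255, §1 (1.20)–(1.22) p.264, (5.10) p.293; Balaban1989LargeFieldII, (1.4) p.357, p.355; Balaban1988Convergent, Thm 1 p.262] -/
theorem tokenFree_of_genericRoadAtWindowWitness (P : Stage13Params F 2 → Prop)
    (hroad : ∀ θ : Stage13Params F 2, P θ → 0 < θ.γ → ∃ β' : ℝ, BetaLowerH (-β') θ.γ (betaOfRecord₁₃ F 2 θ) ∧ BetaUpperH β' θ.γ (betaOfRecord₁₃ F 2 θ))
    (hAt : ∀ a₀ : ℝ, 0 < a₀ → ∃ (j : ℕ) (γ₀ ε₀ ε₂₉ B₃ B₃' a₁ : ℝ), 0 < γ₀ ∧ γ₀ ≤ 1 / 2 ∧ 0 < ε₂₉ ∧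
      P (theta13OfThm1CCMW F 2 j γ₀ ε₀ ε₂₉ B₃ B₃' a₀ a₁)) :
    ∀ a₀ : ℝ, 0 < a₀ → ∃ γ₀ ε₂₉ β' : ℝ, 0 < γ₀ ∧ 0 < ε₂₉ ∧ ∀ (j : ℕ) (ε₀ B₃ B₃' a₁ : ℝ),
      BetaLowerH (-β') γ₀ (betaOfRecord₁₃ F 2 (theta13OfThm1CCM F 2 j ε₀ ε₂₉ B₃ B₃' a₀ a₁)) ∧
      BetaUpperH β' γ₀ (betaOfRecord₁₃ F 2 (theta13OfThm1CCM F 2 j ε₀ ε₂₉ B₃ B₃' a₀ a₁)) := by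
  intro a₀ ha₀
  obtain ⟨j, γ₀, ε₀, ε₂₉, B₃, B₃', a₁, hγ₀, hγh, hε', hP⟩ := hAt a₀ ha₀
  have hγ : 0 < (theta13OfThm1CCMW F 2 j γ₀ ε₀ ε₂₉ B₃ B₃' a₀ a₁).γ := by rw [theta13OfThm1CCMW_γ]; exact hγ₀
  obtain ⟨β', hlow, hup⟩ := hroad _ hP hγ
  rw [theta13OfThm1CCMW_γ] at hlow hup
  refine ⟨γ₀, ε₂₉, β', hγ₀, hε', fun j' ε₀' C₃ C₃' c₁ => ?_⟩
  rw [betaOfRecord₁₃_theta13OfThm1CCM_letterBlind F 2 j' j ε₀' ε₀ ε₂₉ C₃ B₃ C₃' B₃' a₀ c₁ a₁]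
  exact ⟨betaLowerH_half_of_theta13OfThm1CCMW hγh hlow, betaUpperH_half_of_theta13OfThm1CCMW hγh hup⟩

/-- **THE WINDOW EDITION OF 3ᴬ′-R** (p618788's `abs3A'_of_ownWindowBoxAt` with R tokens): own-window boxes at SOME window witness `θ₁₅ᶜᶜᴹᵂ(j; γ₀)`, `0 < γ₀ ≤ ½`, per tuple carrying the
floor-carrying tokens ⟹ the option-R text (the G twin is the same two lines; omitted).  CONDITIONAL on the boxes.
[cite: Balaban1987RG1, Thm 1 p.255, (1.20)–(1.22) p.264, §1 p.264; Balaban1989LargeFieldII, (1.4) p.357; Balaban1985Variational, Thm 1 (8)–(9) p.279, p.304 lines 1–2] -/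
theorem abs3A'R_of_ownWindowBoxAtR
    (h : ∀ (j c : ℕ) (B₃ B₃' a₀ a₁ : ℝ), c ≤ F.L ^ j → 2 * (F.L : ℝ) ^ 2 ≤ B₃ → 0 < B₃' → 0 < a₀ → 0 < a₁ →
      VariationalThm1RegSepCoP7MR F 2 c B₃ a₀ a₁ →
      Gauge9RegSepTopStepR F 2 (fun ν K Ω => suppDomOfRecord F ν K Ω) (F.L ^ j) c B₃ B₃' a₀ a₁ →
      ∃ γ₀ ε₀ ε₂₉ β' : ℝ, 0 < γ₀ ∧ γ₀ ≤ 1 / 2 ∧ 0 < ε₀ ∧ 0 < ε₂₉ ∧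
        BetaLowerH (-β') (theta13OfThm1CCMW F 2 j γ₀ ε₀ ε₂₉ B₃ B₃' a₀ a₁).γ (betaOfRecord₁₃ F 2 (theta13OfThm1CCMW F 2 j γ₀ ε₀ ε₂₉ B₃ B₃' a₀ a₁)) ∧
        BetaUpperH β' (theta13OfThm1CCMW F 2 j γ₀ ε₀ ε₂₉ B₃ B₃' a₀ a₁).γ (betaOfRecord₁₃ F 2 (theta13OfThm1CCMW F 2 j γ₀ ε₀ ε₂₉ B₃ B₃' a₀ a₁))) :
    ∀ (j c : ℕ) (B₃ B₃' a₀ a₁ : ℝ), c ≤ F.L ^ j → 2 * (F.L : ℝ) ^ 2 ≤ B₃ → 0 < B₃' → 0 < a₀ → 0 < a₁ →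
      VariationalThm1RegSepCoP7MR F 2 c B₃ a₀ a₁ →
      Gauge9RegSepTopStepR F 2 (fun ν K Ω => suppDomOfRecord F ν K Ω) (F.L ^ j) c B₃ B₃' a₀ a₁ →
      ∃ γ₀ ε₀ ε₂₉ β' : ℝ, 0 < γ₀ ∧ 0 < ε₀ ∧ 0 < ε₂₉ ∧
        BetaLowerH (-β') γ₀ (betaOfRecord₁₃ F 2 (theta13OfThm1CCM F 2 j ε₀ ε₂₉ B₃ B₃' a₀ a₁)) ∧
        BetaUpperH β' γ₀ (betaOfRecord₁₃ F 2 (theta13OfThm1CCM F 2 j ε₀ ε₂₉ B₃ B₃' a₀ a₁)) := by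
  intro j c B₃ B₃' a₀ a₁ hc hB hB' ha₀ ha₁ h15 h9
  obtain ⟨γ₀, ε₀, ε₂₉, β', hγ₀, hγh, hε, hε', hlow, hup⟩ := h j c B₃ B₃' a₀ a₁ hc hB hB' ha₀ ha₁ h15 h9
  rw [theta13OfThm1CCMW_γ] at hlow hup
  exact ⟨γ₀, ε₀, ε₂₉, β', hγ₀, hε, hε', betaLowerH_half_of_theta13OfThm1CCMW hγh hlow, betaUpperH_half_of_theta13OfThm1CCMW hγh hup⟩

end Schema

/-! ## §6  K0⁷ BY NAME under the V20-R stub-1 TEXT (k0-s1-w3 g7's composition p630277, stub 2′ discharged BY NAME p595104) and each stub-3 text ∕ core ∕ road; and from V19's stub 1 + G -/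

section ByName

/-- **★★ K0⁷ BY NAME FROM THE V20-R STUB-1 TEXT AND THE 3ᴬ′-R TEXT** — k0-s1-w3 g7's `record13SepCoPHBody_of_stubs1R_2P_3A'R` (p630277) with stub 2′ BY NAME
(`K0V19Stub2Prime.stub_prop6MemberB8AtP13`, p595104): the interim V20-R skeleton would register TWO stubs, and this is its by-name closer.  CONDITIONAL on both texts (displayed, NOT proved
here); K0⁷ OPEN; a helper, not a closer. [cite: Balaban1985Variational, Thm 1 (8)–(9) p.279, (144)–(152) pp.300–301, Prop. 8 p.304, p.304 lines 1–2; Balaban1985RegularSpaces, Prop. 6 p.99, p.98; Balaban1988Convergent, Thm 1 p.262; Balaban1987RG1, Thm 1 p.259, §1 p.264] -/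
theorem record13SepCoPHInhabited_of_stub1R_abs3A'R_byName
    (h1R : ∀ F : T4Family, ∃ (c : ℕ) (B₃ a₀ a₁ : ℝ), 2 * (F.L : ℝ) ^ 2 ≤ B₃ ∧ 0 < a₀ ∧ 0 < a₁ ∧
      Prop8RegSepTopStepR F 2 (fun ν K Ω => suppDomOfRecord F ν K Ω) c B₃ a₀ a₁)
    (h3R : ∀ (F : T4Family) (j c : ℕ) (B₃ B₃' a₀ a₁ : ℝ), c ≤ F.L ^ j → 2 * (F.L : ℝ) ^ 2 ≤ B₃ → 0 < B₃' → 0 < a₀ → 0 < a₁ →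
      VariationalThm1RegSepCoP7MR F 2 c B₃ a₀ a₁ →
      Gauge9RegSepTopStepR F 2 (fun ν K Ω => suppDomOfRecord F ν K Ω) (F.L ^ j) c B₃ B₃' a₀ a₁ →
      ∃ γ₀ ε₀ ε₂₉ β' : ℝ, 0 < γ₀ ∧ 0 < ε₀ ∧ 0 < ε₂₉ ∧
        BetaLowerH (-β') γ₀ (betaOfRecord₁₃ F 2 (theta13OfThm1CCM F 2 j ε₀ ε₂₉ B₃ B₃' a₀ a₁)) ∧
        BetaUpperH β' γ₀ (betaOfRecord₁₃ F 2 (theta13OfThm1CCM F 2 j ε₀ ε₂₉ B₃ B₃' a₀ a₁))) :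
    Summit.QuantumFields.YangMills.Theses.BalabanUVNodes.Record13SepCoPHInhabited :=
  record13SepCoPHBody_of_stubs1R_2P_3A'R h1R stub_prop6MemberB8AtP13 h3R

/-- **★★ K0⁷ BY NAME FROM THE V20-R STUB-1 TEXT AND THE 3ᴬ′-G♭ TEXT** (hence from the plan's 3ᴬ′-G, next).  CONDITIONAL on both texts; K0⁷ OPEN; a helper, not a closer.
[cite: Balaban1985Variational, Thm 1 (8)–(9) p.279, Prop. 8 p.304, p.304 lines 1–2; Balaban1985RegularSpaces, Prop. 6 p.99; Balaban1988Convergent, Thm 1 p.262; Balaban1987RG1, Thm 1 p.259, §1 p.264, (0.1) p.251] -/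
theorem record13SepCoPHInhabited_of_stub1R_abs3A'Gb_byName
    (h1R : ∀ F : T4Family, ∃ (c : ℕ) (B₃ a₀ a₁ : ℝ), 2 * (F.L : ℝ) ^ 2 ≤ B₃ ∧ 0 < a₀ ∧ 0 < a₁ ∧
      Prop8RegSepTopStepR F 2 (fun ν K Ω => suppDomOfRecord F ν K Ω) c B₃ a₀ a₁)
    (h3Gb : ∀ (F : T4Family) (j c c₀ : ℕ) (B₃ B₃' a₀ a₁ : ℝ), c ≤ F.L ^ j → c₀ ≤ j + 1 → 2 * (F.L : ℝ) ^ 2 ≤ B₃ → 0 < B₃' → 0 < a₀ → 0 < a₁ →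
      VariationalThm1RegSepCoP7MG F 2 (fun ν _M _g K k _s => c ≤ ν.M₁ ∧ k + c₀ ≤ F.m + K) B₃ a₀ a₁ →
      Gauge9RegSepTopStepG F 2 (fun ν K Ω => suppDomOfRecord F ν K Ω) (F.L ^ j) (fun ν _M _g K k _s => c ≤ ν.M₁ ∧ k + c₀ ≤ F.m + K) B₃ B₃' a₀ a₁ →
      ∃ γ₀ ε₀ ε₂₉ β' : ℝ, 0 < γ₀ ∧ 0 < ε₀ ∧ 0 < ε₂₉ ∧
        BetaLowerH (-β') γ₀ (betaOfRecord₁₃ F 2 (theta13OfThm1CCM F 2 j ε₀ ε₂₉ B₃ B₃' a₀ a₁)) ∧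
        BetaUpperH β' γ₀ (betaOfRecord₁₃ F 2 (theta13OfThm1CCM F 2 j ε₀ ε₂₉ B₃ B₃' a₀ a₁))) :
    Summit.QuantumFields.YangMills.Theses.BalabanUVNodes.Record13SepCoPHInhabited :=
  record13SepCoPHInhabited_of_stub1R_abs3A'R_byName h1R fun F => abs3A'R_of_abs3A'Gb F (h3Gb F)

/-- **★★ K0⁷ BY NAME FROM THE V20-R STUB-1 TEXT AND THE PLAN's 3ᴬ′-G TEXT.**  CONDITIONAL on both texts; K0⁷ OPEN; a helper, not a closer.
[cite: Balaban1985Variational, Thm 1 (8)–(9) p.279, Prop. 8 p.304, p.304 lines 1–2; Balaban1985RegularSpaces, Prop. 6 p.99; Balaban1988Convergent, Thm 1 p.262; Balaban1987RG1, Thm 1 p.259, §1 p.264, (0.1) p.251] -/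
theorem record13SepCoPHInhabited_of_stub1R_abs3A'G_byName
    (h1R : ∀ F : T4Family, ∃ (c : ℕ) (B₃ a₀ a₁ : ℝ), 2 * (F.L : ℝ) ^ 2 ≤ B₃ ∧ 0 < a₀ ∧ 0 < a₁ ∧
      Prop8RegSepTopStepR F 2 (fun ν K Ω => suppDomOfRecord F ν K Ω) c B₃ a₀ a₁)
    (h3G : ∀ (F : T4Family) (j c c₀ : ℕ) (B₃ B₃' a₀ a₁ : ℝ), c ≤ F.L ^ j → 2 * (F.L : ℝ) ^ 2 ≤ B₃ → 0 < B₃' → 0 < a₀ → 0 < a₁ →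
      VariationalThm1RegSepCoP7MG F 2 (fun ν _M _g K k _s => c ≤ ν.M₁ ∧ k + c₀ ≤ F.m + K) B₃ a₀ a₁ →
      Gauge9RegSepTopStepG F 2 (fun ν K Ω => suppDomOfRecord F ν K Ω) (F.L ^ j) (fun ν _M _g K k _s => c ≤ ν.M₁ ∧ k + c₀ ≤ F.m + K) B₃ B₃' a₀ a₁ →
      ∃ γ₀ ε₀ ε₂₉ β' : ℝ, 0 < γ₀ ∧ 0 < ε₀ ∧ 0 < ε₂₉ ∧
        BetaLowerH (-β') γ₀ (betaOfRecord₁₃ F 2 (theta13OfThm1CCM F 2 j ε₀ ε₂₉ B₃ B₃' a₀ a₁)) ∧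
        BetaUpperH β' γ₀ (betaOfRecord₁₃ F 2 (theta13OfThm1CCM F 2 j ε₀ ε₂₉ B₃ B₃' a₀ a₁))) :
    Summit.QuantumFields.YangMills.Theses.BalabanUVNodes.Record13SepCoPHInhabited :=
  record13SepCoPHInhabited_of_stub1R_abs3A'R_byName h1R fun F => abs3A'R_of_abs3A'G F (h3G F)

/-- **★★★ K0⁷ BY NAME FROM THE V20-R STUB-1 TEXT AND THE TOKEN-FREE BOX CORE** (ONE sign-free box of `β₁₃(F; a₀, ε₂₉)` per threshold — NODE O's bill, text-independent).  CONDITIONAL;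
K0⁷ OPEN; a helper, not a closer. [cite: Balaban1985Variational, Thm 1 (8)–(9) p.279, Prop. 8 p.304, p.304 lines 1–2; Balaban1985RegularSpaces, Prop. 6 p.99; Balaban1988Convergent, Thm 1 p.262; Balaban1987RG1, Thm 1 p.259, §1 p.264; Balaban1989LargeFieldII, p.355] -/
theorem record13SepCoPHInhabited_of_stub1R_tokenFree_byName
    (h1R : ∀ F : T4Family, ∃ (c : ℕ) (B₃ a₀ a₁ : ℝ), 2 * (F.L : ℝ) ^ 2 ≤ B₃ ∧ 0 < a₀ ∧ 0 < a₁ ∧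
      Prop8RegSepTopStepR F 2 (fun ν K Ω => suppDomOfRecord F ν K Ω) c B₃ a₀ a₁)
    (hT : ∀ (F : T4Family) (a₀ : ℝ), 0 < a₀ → ∃ γ₀ ε₂₉ β' : ℝ, 0 < γ₀ ∧ 0 < ε₂₉ ∧ ∀ (j : ℕ) (ε₀ B₃ B₃' a₁ : ℝ),
      BetaLowerH (-β') γ₀ (betaOfRecord₁₃ F 2 (theta13OfThm1CCM F 2 j ε₀ ε₂₉ B₃ B₃' a₀ a₁)) ∧
      BetaUpperH β' γ₀ (betaOfRecord₁₃ F 2 (theta13OfThm1CCM F 2 j ε₀ ε₂₉ B₃ B₃' a₀ a₁))) :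
    Summit.QuantumFields.YangMills.Theses.BalabanUVNodes.Record13SepCoPHInhabited :=
  record13SepCoPHInhabited_of_stub1R_abs3A'R_byName h1R fun F => abs3A'R_of_tokenFree F (hT F)

/-- **★★ K0⁷ BY NAME FROM THE V20-R STUB-1 TEXT AND ANY θ-GENERIC OWN-WINDOW BOX ROAD INHABITED AT ONE SMALL-WINDOW WITNESS PER THRESHOLD** (§5's schema per family).  CONDITIONAL on
`h1R`, the roads and their packages `P F` (displayed, inhabited nowhere); K0⁷ OPEN; a helper, not a closer. [cite: Balaban1985Variational, Thm 1 (8)–(9) p.279, Prop. 8 p.304; Balaban1985RegularSpaces, Prop. 6 p.99; Balaban1988Convergent, Thm 1 p.262; Balaban1987RG1, Thm 1 p.255, §1 p.264, (5.10) p.293; Balaban1989LargeFieldII, (1.4) p.357] -/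
theorem record13SepCoPHInhabited_of_stub1R_genericRoadAtWindowWitness_byName
    (h1R : ∀ F : T4Family, ∃ (c : ℕ) (B₃ a₀ a₁ : ℝ), 2 * (F.L : ℝ) ^ 2 ≤ B₃ ∧ 0 < a₀ ∧ 0 < a₁ ∧
      Prop8RegSepTopStepR F 2 (fun ν K Ω => suppDomOfRecord F ν K Ω) c B₃ a₀ a₁)
    (P : (F : T4Family) → Stage13Params F 2 → Prop)
    (hroad : ∀ (F : T4Family) (θ : Stage13Params F 2), P F θ → 0 < θ.γ →
      ∃ β' : ℝ, BetaLowerH (-β') θ.γ (betaOfRecord₁₃ F 2 θ) ∧ BetaUpperH β' θ.γ (betaOfRecord₁₃ F 2 θ))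
    (hAt : ∀ (F : T4Family) (a₀ : ℝ), 0 < a₀ → ∃ (j : ℕ) (γ₀ ε₀ ε₂₉ B₃ B₃' a₁ : ℝ), 0 < γ₀ ∧ γ₀ ≤ 1 / 2 ∧ 0 < ε₂₉ ∧
      P F (theta13OfThm1CCMW F 2 j γ₀ ε₀ ε₂₉ B₃ B₃' a₀ a₁)) :
    Summit.QuantumFields.YangMills.Theses.BalabanUVNodes.Record13SepCoPHInhabited :=
  record13SepCoPHInhabited_of_stub1R_tokenFree_byName h1R fun F => tokenFree_of_genericRoadAtWindowWitness F (P F) (hroad F) (hAt F)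

/-- **K0⁷ BY NAME FROM V19's REGISTERED STUB-1 TEXT AND THE PLAN's 3ᴬ′-G TEXT** (through V19's by-name composition `K0V19Stub2Prime.record13SepCoPHInhabited_of_stub1_stub3A'_byName` and §4's
`abs3A'V19_of_abs3A'G`).  So while V19 STANDS, a by-name proof of V19's `stub_prop8StepCoP13` together with one of `stub_absBetaBoxAtThm1WitnessCCMGenG13`'s text closes K0⁷ through this
line.  CONDITIONAL on both texts; K0⁷ OPEN; a helper, not a closer. [cite: Balaban1985Variational, Thm 1 (8)–(9) p.279, Prop. 8 p.304; Balaban1985RegularSpaces, Prop. 6 p.99; Balaban1988Convergent, Thm 1 p.262; Balaban1987RG1, Thm 1 p.259, §1 p.264, (0.1) p.251] -/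
theorem record13SepCoPHInhabited_of_stub1_abs3A'G_byName (h1 : ∀ F : T4Family, Prop8StepCoPAt F)
    (h3G : ∀ (F : T4Family) (j c c₀ : ℕ) (B₃ B₃' a₀ a₁ : ℝ), c ≤ F.L ^ j → 2 * (F.L : ℝ) ^ 2 ≤ B₃ → 0 < B₃' → 0 < a₀ → 0 < a₁ →
      VariationalThm1RegSepCoP7MG F 2 (fun ν _M _g K k _s => c ≤ ν.M₁ ∧ k + c₀ ≤ F.m + K) B₃ a₀ a₁ →
      Gauge9RegSepTopStepG F 2 (fun ν K Ω => suppDomOfRecord F ν K Ω) (F.L ^ j) (fun ν _M _g K k _s => c ≤ ν.M₁ ∧ k + c₀ ≤ F.m + K) B₃ B₃' a₀ a₁ →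
      ∃ γ₀ ε₀ ε₂₉ β' : ℝ, 0 < γ₀ ∧ 0 < ε₀ ∧ 0 < ε₂₉ ∧
        BetaLowerH (-β') γ₀ (betaOfRecord₁₃ F 2 (theta13OfThm1CCM F 2 j ε₀ ε₂₉ B₃ B₃' a₀ a₁)) ∧
        BetaUpperH β' γ₀ (betaOfRecord₁₃ F 2 (theta13OfThm1CCM F 2 j ε₀ ε₂₉ B₃ B₃' a₀ a₁))) :
    Summit.QuantumFields.YangMills.Theses.BalabanUVNodes.Record13SepCoPHInhabited :=
  record13SepCoPHInhabited_of_stub1_stub3A'_byName h1 fun F => abs3A'V19_of_abs3A'G F (h3G F)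

end ByName

end Summit.QuantumFields.YangMills.Theorems.K0Stub3V20Sockets

end
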